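import Literature.NumberTheory.LFunctions.LagariasXiShiftHermiteBiehlerProofs
import HarnessLib

/-!
# The disc comparison for `|ξ|` on horizontal lines (RH-FREE)

LINE 1 / LABEL: RH-FREE theorem about Riemann's `ξ`; the RH-EQUIVALENT statement «`‖ξ(σ+it)‖`
increasing in `σ > ½` for every `t`» (Sondow–Dumitrescu, tree
`Literature.NumberTheory.LFunctions.SondowDumitrescu2010.riemannHypothesis_iff_norm_riemannXi_strictMonoOn`)
is NOT touched; nothing here is progress toward RH. bears_on: LADDER-RH B-P(P2)/(P3) (cell rh-dbr,
theory TARGET-v9 §M.3 T1; idea-2 g3 `XiDiscComparison`). WHAT THIS IS NOT: not a positivity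
statement, not a de Branges/Suzuki door inhabitant.

**Theorem** (`norm_riemannXi_lt_of_disc`). For real `σ₁, σ₂, t` with `|σ₁ − ½| < |σ₂ − ½|` and
`(σ₁ − ½)² + (σ₂ − ½)² ≥ ½`:  `‖ξ(σ₁ + it)‖ < ‖ξ(σ₂ + it)‖`.

The known unconditional monotonicity results are the sub-cases `|σ₁ − ½| ≥ ½` (Sondow–Dumitrescu
2010 Thm 1 outside the strip; Matiyasevich–Saidak–Zvengrowski) and the tangent lines
`|σ₁ − ½| + |σ₂ − ½| = 2h`, `h ≥ ½` (Lagarias 2005 Lemma 2.1 (1), tree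
`Literature.NumberTheory.LFunctions.lagarias2005_lemma_2_1_holds`); the disc `d₁² + d₂² < ½` is the
exact obstruction region of the pair-by-pair method.

## Proof (pair-by-pair in the Hadamard product, with conjugate pairing of the factors)

Template: the tree's proof of `lagarias2005_lemma_2_1_holds`
(`LagariasXiShiftHermiteBiehlerProofs.lean`). For a Hadamard sequence `b` of de Bruijn's `H₀`
(`Literature.NumberTheory.LFunctions.exists_isHadamardSeq`) the tree proves
`log‖ξ(u)‖ − log‖ξ(v)‖ = ∑ₙ [log‖fₙ(u)‖ − log‖fₙ(v)‖]`, `fₙ(s) = 1 − bₙ(2s−1)² = −4bₙ(s−ρₙ)(s−(1−ρₙ))`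
(`IsHadamardSeq.hasSum_log_norm_factors_sub`, `factor_eq_mul`), `0 < Re ρₙ < 1`
(`riemannZeta_xiZero`), and that the multiset `{bₙ}` is closed under conjugation through a
permutation `π` of the indices (`IsHadamardSeq.exists_perm_eq_conj`). A single factor is NOT
monotone in `|σ − ½|` here; but `‖f_{πn}(s)‖ = ‖fₙ(s̄)‖`, and for `s = ½ + u + it`, `ρₙ = ½ + β + iγ`,
`‖fₙ(s)‖·‖fₙ(s̄)‖ = 16‖bₙ‖² √(F_{t−γ}(u²) F_{t+γ}(u²))` with
`F_T(v) = ((u−β)² + T²)((u+β)² + T²) = (v + β² + T²)² − 4vβ²` and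
`F_T(v₂) − F_T(v₁) = (v₂ − v₁)(v₁ + v₂ + 2T² − 2β²) > 0` whenever `v₁ < v₂`, `v₁ + v₂ ≥ ½ > 2β²`
(`|β| < ½`). Summing the series once over `n` and once over `πn` gives
`2(log‖ξ(s₂)‖ − log‖ξ(s₁)‖) = ∑ₙ [Dₙ + D_{πn}]` with every term `≥ 0` and the terms with `bₙ ≠ 0`
positive (`IsHadamardSeq.exists_ne_zero`). `ξ(s₂) ≠ 0` because `|σ₂ − ½| > ½`
(`riemannXi_eq_zero_iff_holds`); if `ξ(s₁) = 0` there is nothing to prove.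

## References (method)

* J. C. Lagarias, *Zero spacing distributions for differenced L-functions*, Acta Arith. 120
  (2005), Lemma 2.1 (1) and its proof (term by term in the Hadamard product). [Lagarias2005]
* J. Sondow, C. Dumitrescu, Period. Math. Hungar. 60 (2010) 37–40. [SondowDumitrescu2010]
-/

noncomputable section

set_option linter.dupNamespace false

open Complex
open scoped ComplexConjugate

namespace Summit.RiemannHypothesis.RiemannHypothesis.Theorems.XiDiscComparison

open Literature.NumberTheory.LFunctions

/-! ## The quartic of one conjugate pair of factors -/

/-- The real-variable core: `F_T(u) = ((u−β)²+T²)((u+β)²+T²)` is strictly increasing in `u²` on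
the region `u₁² + u₂² ≥ ½` when `β² < ¼`, since
`F_T(u₂) − F_T(u₁) = (u₂² − u₁²)(u₁² + u₂² + 2T² − 2β²)`. -/
theorem quartic_lt {u₁ u₂ β T : ℝ} (hu : u₁ ^ 2 < u₂ ^ 2) (hd : 1 / 2 ≤ u₁ ^ 2 + u₂ ^ 2)
    (hβ : β ^ 2 < 1 / 4) :
    ((u₁ - β) ^ 2 + T ^ 2) * ((u₁ + β) ^ 2 + T ^ 2) <
      ((u₂ - β) ^ 2 + T ^ 2) * ((u₂ + β) ^ 2 + T ^ 2) := by
  have e : ((u₂ - β) ^ 2 + T ^ 2) * ((u₂ + β) ^ 2 + T ^ 2) -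
      ((u₁ - β) ^ 2 + T ^ 2) * ((u₁ + β) ^ 2 + T ^ 2) =
      (u₂ ^ 2 - u₁ ^ 2) * (u₁ ^ 2 + u₂ ^ 2 + 2 * T ^ 2 - 2 * β ^ 2) := by ring
  have h1 : 0 < u₂ ^ 2 - u₁ ^ 2 := sub_pos.2 hu
  have h2 : 0 < u₁ ^ 2 + u₂ ^ 2 + 2 * T ^ 2 - 2 * β ^ 2 := by nlinarith [sq_nonneg T]
  have := mul_pos h1 h2
  linarith

/-- One conjugate pair of linear factors: for `0 < Re ρ < 1` and `s₁, s₂` on the same horizontal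
line with `|Re s₁ − ½| < |Re s₂ − ½|`, `(Re s₁ − ½)² + (Re s₂ − ½)² ≥ ½`:
`‖s₁ − ρ‖·‖s̄₁ − (1 − ρ)‖ < ‖s₂ − ρ‖·‖s̄₂ − (1 − ρ)‖`. -/
theorem norm_mul_norm_conj_lt {ρ s₁ s₂ : ℂ} (hρ0 : 0 < ρ.re) (hρ1 : ρ.re < 1)
    (him : s₁.im = s₂.im) (habs : |s₁.re - 1 / 2| < |s₂.re - 1 / 2|)
    (hdisc : 1 / 2 ≤ (s₁.re - 1 / 2) ^ 2 + (s₂.re - 1 / 2) ^ 2) :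
    ‖s₁ - ρ‖ * ‖conj s₁ - (1 - ρ)‖ < ‖s₂ - ρ‖ * ‖conj s₂ - (1 - ρ)‖ := by
  have hu : (s₁.re - 1 / 2) ^ 2 < (s₂.re - 1 / 2) ^ 2 := sq_lt_sq.2 habs
  have hβ : (ρ.re - 1 / 2) ^ 2 < 1 / 4 := by nlinarith
  have key := quartic_lt (T := s₁.im - ρ.im) hu hdisc hβ
  refine (sq_lt_sq₀ (by positivity) (by positivity)).1 ?_
  rw [mul_pow, mul_pow, Complex.sq_norm, Complex.sq_norm, Complex.sq_norm, Complex.sq_norm,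
    Complex.normSq_apply, Complex.normSq_apply, Complex.normSq_apply, Complex.normSq_apply]
  simp only [sub_re, sub_im, one_re, one_im, conj_re, conj_im]
  have e1 : (s₁.re - ρ.re) * (s₁.re - ρ.re) + (s₁.im - ρ.im) * (s₁.im - ρ.im) =
      (s₁.re - 1 / 2 - (ρ.re - 1 / 2)) ^ 2 + (s₁.im - ρ.im) ^ 2 := by ring
  have e2 : (s₁.re - (1 - ρ.re)) * (s₁.re - (1 - ρ.re)) + (-s₁.im - (0 - ρ.im)) * (-s₁.im - (0 - ρ.im)) =
      (s₁.re - 1 / 2 + (ρ.re - 1 / 2)) ^ 2 + (s₁.im - ρ.im) ^ 2 := by ring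
  have e3 : (s₂.re - ρ.re) * (s₂.re - ρ.re) + (s₂.im - ρ.im) * (s₂.im - ρ.im) =
      (s₂.re - 1 / 2 - (ρ.re - 1 / 2)) ^ 2 + (s₁.im - ρ.im) ^ 2 := by rw [← him]; ring
  have e4 : (s₂.re - (1 - ρ.re)) * (s₂.re - (1 - ρ.re)) + (-s₂.im - (0 - ρ.im)) * (-s₂.im - (0 - ρ.im)) =
      (s₂.re - 1 / 2 + (ρ.re - 1 / 2)) ^ 2 + (s₁.im - ρ.im) ^ 2 := by rw [← him]; ring
  rw [e1, e2, e3, e4]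
  exact key


/-! ## The Hadamard factors: a factor times its conjugate-partner factor -/

namespace IsHadamardSeqAux

variable {b : ℕ → ℂ}

/-- The conjugate-partner factor: `‖1 − conj(bₙ)(2s−1)²‖ = ‖1 − bₙ(2s̄−1)²‖ = ‖fₙ(s̄)‖`. -/
theorem norm_factor_conj (c s : ℂ) :
    ‖1 - conj c * (2 * s - 1) ^ 2‖ = ‖1 - c * (2 * conj s - 1) ^ 2‖ := by
  rw [← Complex.norm_conj (1 - conj c * (2 * s - 1) ^ 2)]
  congr 1
  simp only [map_sub, map_one, map_mul, map_pow, Complex.conj_conj, map_ofNat]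

/-- **Pair-by-pair strict inequality**: for a Hadamard sequence `b` of `H₀`, an index `n` with
`bₙ ≠ 0`, and `s₁, s₂` on one horizontal line with `|Re s₁ − ½| < |Re s₂ − ½|` and
`(Re s₁ − ½)² + (Re s₂ − ½)² ≥ ½`:  `‖fₙ(s₁)‖·‖fₙ(s̄₁)‖ < ‖fₙ(s₂)‖·‖fₙ(s̄₂)‖`
(`fₙ(s) = 1 − bₙ(2s−1)² = −4bₙ(s−ρₙ)(s−(1−ρₙ))`, `0 < Re ρₙ < 1`). -/
theorem norm_factor_mul_norm_factor_conj_lt (hb : IsHadamardSeq 0 b) {n : ℕ} (hn : b n ≠ 0)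
    {s₁ s₂ : ℂ} (him : s₁.im = s₂.im) (habs : |s₁.re - 1 / 2| < |s₂.re - 1 / 2|)
    (hdisc : 1 / 2 ≤ (s₁.re - 1 / 2) ^ 2 + (s₂.re - 1 / 2) ^ 2) :
    ‖1 - b n * (2 * s₁ - 1) ^ 2‖ * ‖1 - b n * (2 * conj s₁ - 1) ^ 2‖ <
      ‖1 - b n * (2 * s₂ - 1) ^ 2‖ * ‖1 - b n * (2 * conj s₂ - 1) ^ 2‖ := by
  have hρ := hb.riemannZeta_xiZero hn
  set ρ := IsHadamardSeq.xiZero b n with hρdef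
  rw [IsHadamardSeq.factor_eq_mul b hn, IsHadamardSeq.factor_eq_mul b hn,
    IsHadamardSeq.factor_eq_mul b hn, IsHadamardSeq.factor_eq_mul b hn]
  simp only [norm_mul]
  have h4 : 0 < ‖(-4 : ℂ)‖ * ‖b n‖ :=
    mul_pos (norm_pos_iff.2 (by norm_num)) (norm_pos_iff.2 hn)
  -- the two conjugate pairs of linear factors
  have hA : ‖s₁ - ρ‖ * ‖conj s₁ - (1 - ρ)‖ < ‖s₂ - ρ‖ * ‖conj s₂ - (1 - ρ)‖ :=
    norm_mul_norm_conj_lt hρ.2.1 hρ.2.2 him habs hdisc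
  have hB : ‖s₁ - (1 - ρ)‖ * ‖conj s₁ - ρ‖ < ‖s₂ - (1 - ρ)‖ * ‖conj s₂ - ρ‖ := by
    have h := norm_mul_norm_conj_lt (ρ := 1 - ρ) (s₁ := s₁) (s₂ := s₂)
      (by simp only [sub_re, one_re]; linarith [hρ.2.2])
      (by simp only [sub_re, one_re]; linarith [hρ.2.1]) him habs hdisc
    simpa only [sub_sub_cancel] using h
  have hAB := mul_lt_mul'' hA hB (by positivity) (by positivity)
  have e : ∀ s : ℂ, ‖(-4 : ℂ)‖ * ‖b n‖ * (‖s - ρ‖ * ‖s - (1 - ρ)‖) *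
      (‖(-4 : ℂ)‖ * ‖b n‖ * (‖conj s - ρ‖ * ‖conj s - (1 - ρ)‖)) =
      (‖(-4 : ℂ)‖ * ‖b n‖) ^ 2 * ((‖s - ρ‖ * ‖conj s - (1 - ρ)‖) * (‖s - (1 - ρ)‖ * ‖conj s - ρ‖)) :=
    fun s ↦ by ring
  rw [e, e]
  exact mul_lt_mul_of_pos_left hAB (by positivity)

end IsHadamardSeqAux

/-! ## The theorem -/

/-- **Disc comparison for `|ξ|`** (RH-FREE): for real `σ₁, σ₂, t` with `|σ₁ − ½| < |σ₂ − ½|` and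
`(σ₁ − ½)² + (σ₂ − ½)² ≥ ½`, `‖ξ(σ₁ + it)‖ < ‖ξ(σ₂ + it)‖`. Pair by pair in the Hadamard product of
`ξ` (tree `IsHadamardSeq.hasSum_log_norm_factors_sub`), each factor taken together with its
conjugate partner (`IsHadamardSeq.exists_perm_eq_conj`). [cite: Lagarias2005, Lemma 2.1 (1), proof
(method)] -/
theorem norm_riemannXi_lt_of_disc (σ₁ σ₂ t : ℝ) (habs : |σ₁ - 1 / 2| < |σ₂ - 1 / 2|)
    (hdisc : 1 / 2 ≤ (σ₁ - 1 / 2) ^ 2 + (σ₂ - 1 / 2) ^ 2) :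
    ‖riemannXi ((σ₁ : ℂ) + t * I)‖ < ‖riemannXi ((σ₂ : ℂ) + t * I)‖ := by
  set s₁ : ℂ := (σ₁ : ℂ) + t * I with hs₁def
  set s₂ : ℂ := (σ₂ : ℂ) + t * I with hs₂def
  have hre₁ : s₁.re = σ₁ := by simp [hs₁def]
  have hre₂ : s₂.re = σ₂ := by simp [hs₂def]
  have him₁ : s₁.im = t := by simp [hs₁def]
  have him₂ : s₂.im = t := by simp [hs₂def]
  -- `|σ₂ − ½| > ½`, so `ξ(s₂) ≠ 0`
  have hu : (σ₁ - 1 / 2) ^ 2 < (σ₂ - 1 / 2) ^ 2 := sq_lt_sq.2 habs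
  have hσ₂ : 1 / 4 < (σ₂ - 1 / 2) ^ 2 := by linarith
  have hs₂ : riemannXi s₂ ≠ 0 := by
    intro h0
    have h := (riemannXi_eq_zero_iff_holds _).1 h0
    rw [hre₂] at h
    nlinarith [h.2.1, h.2.2]
  -- if `ξ(s₁) = 0` there is nothing to prove
  by_cases hs₁ : riemannXi s₁ = 0
  · rw [hs₁, norm_zero]; exact norm_pos_iff.2 hs₂
  -- the Hadamard product and the conjugation symmetry of its multiset
  obtain ⟨b, hb⟩ := exists_isHadamardSeq 0
  obtain ⟨π, hπ⟩ := hb.exists_perm_eq_conj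
  obtain ⟨n₀, hn₀⟩ := hb.exists_ne_zero
  set D : ℕ → ℝ := fun n ↦ Real.log ‖1 - b n * (2 * s₂ - 1) ^ 2‖ -
    Real.log ‖1 - b n * (2 * s₁ - 1) ^ 2‖ with hD
  have hsum : HasSum D (Real.log ‖riemannXi s₂‖ - Real.log ‖riemannXi s₁‖) :=
    hb.hasSum_log_norm_factors_sub hs₂ hs₁
  have hsumπ : HasSum (D ∘ π) (Real.log ‖riemannXi s₂‖ - Real.log ‖riemannXi s₁‖) :=
    π.hasSum_iff.2 hsum
  have hsum2 : HasSum (fun n ↦ D n + D (π n))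
      (2 * (Real.log ‖riemannXi s₂‖ - Real.log ‖riemannXi s₁‖)) := by
    have := hsum.add hsumπ
    rw [two_mul]
    exact this
  -- hypotheses in the `re/im` form
  have him : s₁.im = s₂.im := by rw [him₁, him₂]
  have habs' : |s₁.re - 1 / 2| < |s₂.re - 1 / 2| := by rw [hre₁, hre₂]; exact habs
  have hdisc' : 1 / 2 ≤ (s₁.re - 1 / 2) ^ 2 + (s₂.re - 1 / 2) ^ 2 := by rw [hre₁, hre₂]; exact hdisc
  -- every non-padding pair term is positive
  have hterm : ∀ n, b n ≠ 0 → 0 < D n + D (π n) := by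
    intro n hn
    have hπn : b (π n) ≠ 0 := by rw [hπ n]; exact (map_ne_zero_iff _ (RingHom.injective _)).2 hn
    have p1 : 0 < ‖1 - b n * (2 * s₁ - 1) ^ 2‖ := norm_pos_iff.2 (hb.factor_ne_zero' hs₁ n)
    have p2 : 0 < ‖1 - b n * (2 * s₂ - 1) ^ 2‖ := norm_pos_iff.2 (hb.factor_ne_zero' hs₂ n)
    have p3 : 0 < ‖1 - b (π n) * (2 * s₁ - 1) ^ 2‖ := norm_pos_iff.2 (hb.factor_ne_zero' hs₁ (π n))
    have p4 : 0 < ‖1 - b (π n) * (2 * s₂ - 1) ^ 2‖ := norm_pos_iff.2 (hb.factor_ne_zero' hs₂ (π n))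
    have q3 : ‖1 - b (π n) * (2 * s₁ - 1) ^ 2‖ = ‖1 - b n * (2 * conj s₁ - 1) ^ 2‖ := by
      rw [hπ n]; exact IsHadamardSeqAux.norm_factor_conj (b n) s₁
    have q4 : ‖1 - b (π n) * (2 * s₂ - 1) ^ 2‖ = ‖1 - b n * (2 * conj s₂ - 1) ^ 2‖ := by
      rw [hπ n]; exact IsHadamardSeqAux.norm_factor_conj (b n) s₂
    have hlt := IsHadamardSeqAux.norm_factor_mul_norm_factor_conj_lt hb hn him habs' hdisc'
    rw [← q3, ← q4] at hlt
    have hlog := Real.log_lt_log (mul_pos p1 p3) hlt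
    rw [Real.log_mul p1.ne' p3.ne', Real.log_mul p2.ne' p4.ne'] at hlog
    simp only [hD]
    linarith
  -- and the padding terms vanish
  have hle : (fun _ : ℕ ↦ (0 : ℝ)) ≤ fun n ↦ D n + D (π n) := by
    intro n
    by_cases hn : b n = 0
    · have hπn : b (π n) = 0 := by rw [hπ n, hn, map_zero]
      simp [hD, hn, hπn]
    · exact (hterm n hn).le
  have hpos : (0 : ℝ) < 2 * (Real.log ‖riemannXi s₂‖ - Real.log ‖riemannXi s₁‖) :=
    hasSum_lt hle (hterm n₀ hn₀) hasSum_zero hsum2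
  have h1 : 0 < ‖riemannXi s₁‖ := norm_pos_iff.2 hs₁
  have h2 : 0 < ‖riemannXi s₂‖ := norm_pos_iff.2 hs₂
  rw [← Real.log_lt_log_iff h1 h2]
  linarith

/-- The same in the `s`-form: for `s₁, s₂` with equal imaginary parts, `|Re s₁ − ½| < |Re s₂ − ½|`
and `(Re s₁ − ½)² + (Re s₂ − ½)² ≥ ½`, `‖ξ(s₁)‖ < ‖ξ(s₂)‖`. -/
theorem norm_riemannXi_lt_of_disc' {s₁ s₂ : ℂ} (him : s₁.im = s₂.im)
    (habs : |s₁.re - 1 / 2| < |s₂.re - 1 / 2|)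
    (hdisc : 1 / 2 ≤ (s₁.re - 1 / 2) ^ 2 + (s₂.re - 1 / 2) ^ 2) :
    ‖riemannXi s₁‖ < ‖riemannXi s₂‖ := by
  have key := norm_riemannXi_lt_of_disc s₁.re s₂.re s₁.im habs hdisc
  rw [Complex.re_add_im s₁] at key
  rw [him, Complex.re_add_im s₂] at key
  exact key

/-- **The one-sided modulus test at every scale `c ≥ 1/(2√2)`** (RH-FREE; idea-2 g3's
`ModulusTest c`, the modulus shadow of de Branges' ratio `ξ(s+2c)/ξ(s)`): for `Re s > ½`,
`‖ξ(s)‖ < ‖ξ(s + 2c)‖`. The ray `((σ−½)², (σ+2c−½)²)`, `σ > ½`, clears the disc iff `8c² ≥ 1`. -/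
theorem norm_riemannXi_lt_norm_riemannXi_add {c : ℝ} (hc : 1 / 8 ≤ c ^ 2) (hc0 : 0 < c) {s : ℂ}
    (hs : 1 / 2 < s.re) : ‖riemannXi s‖ < ‖riemannXi (s + 2 * c)‖ := by
  refine norm_riemannXi_lt_of_disc' (by simp) ?_ ?_
  · simp only [add_re, mul_re, re_ofNat, ofReal_re, im_ofNat, ofReal_im, mul_zero, sub_zero]
    rw [abs_of_pos (by linarith), abs_of_pos (by linarith)]; linarith
  · simp only [add_re, mul_re, re_ofNat, ofReal_re, im_ofNat, ofReal_im, mul_zero, sub_zero]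
    nlinarith [sq_nonneg (s.re - 1 / 2), mul_pos hc0 (by linarith : (0:ℝ) < s.re - 1 / 2)]

end Summit.RiemannHypothesis.RiemannHypothesis.Theorems.XiDiscComparison
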